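import Summits.RiemannHypothesis.RiemannHypothesis.Theorems.JensenPolynomialsEffectiveKimLeeRadius
import Summits.RiemannHypothesis.RiemannHypothesis.Theorems.JensenPolynomialsChainDefs
import HarnessLib

/-!
# Effective Kim–Lee for `ξ₁`: the floor `n ≥ 20 000` (the zero-side crux of the «√d·log d range»)

RH-FREE (line 1, cell rh-jensen discipline; bears_on LADDER-RH J-P(P1″), route «JensenChainBand» of
theory seat rh-jensen-theory g9, leaf `JensenSqrtLogRangeTwenty`; nothing here bears on the truth of
RH — under RH every `ξ₁⁽ⁿ⁾` has only real zeros and the statements are vacuous).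

This file lowers the threshold of `EffectiveKimLee.xiSq_derivZeros_nonreal_far` (sibling file
`JensenPolynomialsEffectiveKimLeeRadius.lean`, `n ≥ 2¹⁶`) to the threshold `n ≥ 20 000` of the
rung's floor radius `chainFloor` (`JensenPolynomialsChainDefs.lean`):

* `xiSq_derivZeros_nonreal_far_mid` — the middle regime `20 000 ≤ n < 65 536`: a second slicing of
  the master inequality `EffectiveKimLee.xiSq_derivZeros_real_of_explicit` with the auxiliary radius
  `r = (0.592·q - 3/2)²`, `q = n / log n` (on this range `√n ≤ 0.0702·q`, so the chain radius is
  `≤ 0.3494·q²` and `log(3/2 + √r) = log 0.592 + log n - log log n`).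
* `xiSq_derivZeros_nonreal_far_of_le` — **for every `n ≥ 20 000` and every zero `w` of `ξ₁⁽ⁿ⁾` with
  `Im w ≠ 0`: `(1/64)(n / log n)² ≤ ‖w‖`** (the two regimes glued).
* `xiDerivNonrealZeroBeyond_chainFloor : XiDerivNonrealZeroBeyond chainFloor` — the rung's ZERO-SIDE
  statement in the vocabulary of `JensenPolynomialsChainDefs.lean`, PROVED (no non-real zero of
  `ξ₁⁽ⁿ⁾` below `chainRadius n = (n/log n)²/64` for `n ≥ 20 000`).

Provenance: cell rh-jensen (idea-2 NEGATION-LENS §2 «B2 effective Kim–Lee»; theory g9 decomposition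
2026-08-26T19:47Z), prover-rh-jensen-eng-2-g4-0. AI-produced formalisation; AI review is weaker than
expert review. References: Y.-O. Kim, J. Lee, arXiv:2105.05386, Thm. 2 (ii); H. Ki, Y.-O. Kim, Duke
Math. J. 104 (2000) §2.
-/

noncomputable section

open Complex Filter Set

set_option linter.dupNamespace false

namespace Summit.RiemannHypothesis.RiemannHypothesis.Theorems.JensenPolynomials.EffectiveKimLee

open Literature.NumberTheory.LFunctions

/-! ## Numeric constants for the middle regime -/

/-- `log 20000 = 14 log 2 + log (20000/16384)`. -/
theorem log_20000_eq : Real.log 20000 = 14 * Real.log 2 + Real.log (20000 / 16384) := by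
  rw [show (20000 : ℝ) = 2 ^ 14 * (20000 / 16384) by norm_num, Real.log_mul (by norm_num) (by norm_num),
    Real.log_pow]
  norm_num

/-- `9.88 ≤ log 20000`. -/
theorem log_20000_ge : 9.88 ≤ Real.log 20000 := by
  rw [log_20000_eq]
  have h1 := Real.log_two_gt_d9
  have h2 : 1 - (20000 / 16384 : ℝ)⁻¹ ≤ Real.log (20000 / 16384) :=
    Real.one_sub_inv_le_log_of_pos (by norm_num)
  norm_num at h2
  linarith

/-- `log 20000 ≤ 9.925`. -/
theorem log_20000_le : Real.log 20000 ≤ 9.925 := by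
  rw [log_20000_eq]
  have h1 := Real.log_two_lt_d9
  have h2 : Real.log (20000 / 16384) ≤ 20000 / 16384 - 1 := Real.log_le_sub_one_of_pos (by norm_num)
  norm_num at h2
  linarith

/-- `141.42 ≤ √20000`. -/
theorem sqrt_20000_ge : 141.42 ≤ Real.sqrt 20000 := by
  rw [show (141.42 : ℝ) = Real.sqrt (141.42 ^ 2) by rw [Real.sqrt_sq (by norm_num)]]
  exact Real.sqrt_le_sqrt (by norm_num)

/-- `e² ≤ 20000`. -/
theorem exp_two_le_20000 : Real.exp 2 ≤ 20000 := exp_two_le.trans (by norm_num)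

/-- For `x ≥ 20000`: `log x / √x ≤ 0.0702`. -/
theorem log_div_sqrt_le' {x : ℝ} (hx : 20000 ≤ x) : Real.log x / Real.sqrt x ≤ 0.0702 := by
  have h := Real.log_div_sqrt_antitoneOn (a := 20000) (b := x) exp_two_le_20000
    (exp_two_le_20000.trans hx) hx
  simp only at h
  have hpos : 0 < Real.sqrt 20000 := Real.sqrt_pos.2 (by norm_num)
  have h2 : Real.log 20000 / Real.sqrt 20000 ≤ 0.0702 := by
    rw [div_le_iff₀ hpos]
    have := log_20000_le
    have := sqrt_20000_ge
    nlinarith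
  linarith

/-- `2.2697 ≤ log 9.88`. -/
theorem log_988_ge : 2.2697 ≤ Real.log 9.88 := by
  rw [show (9.88 : ℝ) = 2 ^ 3 * 1.235 by norm_num, Real.log_mul (by norm_num) (by norm_num),
    Real.log_pow]
  have h1 := Real.log_two_gt_d9
  have h2 : 1 - (1.235 : ℝ)⁻¹ ≤ Real.log 1.235 := Real.one_sub_inv_le_log_of_pos (by norm_num)
  norm_num at h2 ⊢
  linarith

/-- `log 0.592 ≤ -0.509`. -/
theorem log_0592_le : Real.log 0.592 ≤ -0.509 := by
  rw [show (0.592 : ℝ) = 1.184 / 2 by norm_num, Real.log_div (by norm_num) (by norm_num)]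
  have h1 := Real.log_two_gt_d9
  have h2 : Real.log 1.184 ≤ 1.184 - 1 := Real.log_le_sub_one_of_pos (by norm_num)
  linarith

/-- `-0.69 ≤ log 0.592`. -/
theorem log_0592_ge : -0.69 ≤ Real.log 0.592 := by
  have h2 : 1 - (0.592 : ℝ)⁻¹ ≤ Real.log 0.592 := Real.one_sub_inv_le_log_of_pos (by norm_num)
  norm_num at h2
  linarith

/-! ## The middle regime `20 000 ≤ n < 65 536` -/

/-- **Effective Kim–Lee, middle regime (RH-FREE).** For `20 000 ≤ n < 65 536` every zero `w` of
`ξ₁⁽ⁿ⁾` with `Im w ≠ 0` satisfies `(1/64)(n / log n)² ≤ ‖w‖`. -/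
theorem xiSq_derivZeros_nonreal_far_mid (n : ℕ) (hn : 20000 ≤ n) (hn' : n < 65536) :
    ∀ w : ℂ, iteratedDeriv n xiSq w = 0 → w.im ≠ 0 →
      1 / 64 * ((n : ℝ) / Real.log n) ^ 2 ≤ ‖w‖ := by
  intro w hw him
  -- real bookkeeping: `x = n`, `L = log x ∈ [9.88, 11.0905]`, `q = x / L`
  have hx20000 : (20000 : ℝ) ≤ (n : ℝ) := by exact_mod_cast hn
  have hx65536 : (n : ℝ) ≤ 65536 := by exact_mod_cast hn'.le
  have hxpos : 0 < (n : ℝ) := by linarith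
  have hLlo : 9.88 ≤ Real.log n :=
    log_20000_ge.trans (Real.log_le_log (by norm_num) hx20000)
  have hLhi : Real.log n ≤ 11.0905 := by
    have h1 : Real.log n ≤ Real.log 65536 := Real.log_le_log hxpos hx65536
    rw [log_65536] at h1
    have h2 := Real.log_two_lt_d9
    linarith
  have hLpos : 0 < Real.log n := by linarith
  set x : ℝ := (n : ℝ) with hx
  set L : ℝ := Real.log x with hL
  set q : ℝ := x / L with hq
  have hqpos : 0 < q := div_pos hxpos hLpos
  have hxqL : x = q * L := by rw [hq]; field_simp
  -- `√x ≤ 0.0702 q`, `141.42 ≤ √x`, hence `q ≥ 2014`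
  have hl2hi := Real.log_two_lt_d9
  have hl2lo := Real.log_two_gt_d9
  have hsx0 : 0 < Real.sqrt x := Real.sqrt_pos.2 hxpos
  have h14142 : 141.42 ≤ Real.sqrt x := sqrt_20000_ge.trans (Real.sqrt_le_sqrt hx20000)
  have hsxq : Real.sqrt x = q * (L / Real.sqrt x) := by
    rw [hq, div_mul_div_comm, mul_comm x L, ← div_mul_div_comm, div_self hLpos.ne', one_mul,
      Real.div_sqrt]
  have hε : L / Real.sqrt x ≤ 0.0702 := log_div_sqrt_le' hx20000
  have hsx : Real.sqrt x ≤ 0.0702 * q := by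
    calc Real.sqrt x = q * (L / Real.sqrt x) := hsxq
      _ ≤ q * 0.0702 := mul_le_mul_of_nonneg_left hε hqpos.le
      _ = 0.0702 * q := mul_comm _ _
  have hq2014 : 2014 ≤ q := by linarith
  have hq2 : (2014 : ℝ) * q ≤ q ^ 2 := by
    have h := mul_le_mul_of_nonneg_left hq2014 hqpos.le
    rw [sq]; linarith
  -- the two radii `R = (q/8)²` and `r = (0.592 q - 3/2)²`
  have hRq : 1 / 64 * q ^ 2 = (q / 8) ^ 2 := by ring
  have hRpos : 0 < 1 / 64 * q ^ 2 := by positivity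
  have hsqrtR : Real.sqrt (1 / 64 * q ^ 2) = q / 8 := by rw [hRq, Real.sqrt_sq (by positivity)]
  set t : ℝ := 0.592 * q - 3 / 2 with ht
  have ht0 : 0 ≤ t := by rw [ht]; linarith
  have hsqrtr : Real.sqrt (t ^ 2) = t := Real.sqrt_sq ht0
  -- (a) the chain radius is at most `r = t²`
  have hs : 1 + Real.sqrt x ≤ 0.0707 * q := by linarith
  have hs0 : 0 ≤ 1 + Real.sqrt x := by positivity
  set V : ℝ := (1 + Real.sqrt x) * (1 + Real.sqrt x + Real.sqrt (1 / 64 * q ^ 2)) with hV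
  have hVb : V ≤ 0.013836 * q ^ 2 := by
    rw [hV, hsqrtR]
    calc (1 + Real.sqrt x) * (1 + Real.sqrt x + q / 8)
        ≤ (0.0707 * q) * (0.0707 * q + q / 8) :=
          mul_le_mul hs (by linarith) (by positivity) (by positivity)
      _ = 0.01383599 * q ^ 2 := by ring
      _ ≤ 0.013836 * q ^ 2 := mul_le_mul_of_nonneg_right (by norm_num) (sq_nonneg q)
  have hV0 : 0 ≤ V := by rw [hV, hsqrtR]; positivity
  have he2 := exp_two_le
  have hchain : (1 / 64 * q ^ 2 + V + 1 / 4) + Real.exp 2 * (1 / 64 * q ^ 2 + 2 * V + 1 / 4)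
      ≤ t ^ 2 := by
    have hpos : 0 ≤ 1 / 64 * q ^ 2 + 2 * V + 1 / 4 := by positivity
    have h1 : (1 / 64 * q ^ 2 + V + 1 / 4) + Real.exp 2 * (1 / 64 * q ^ 2 + 2 * V + 1 / 4) ≤
        (1 / 64 * q ^ 2 + V + 1 / 4) + 7.3891 * (1 / 64 * q ^ 2 + 2 * V + 1 / 4) :=
      add_le_add le_rfl (mul_le_mul_of_nonneg_right he2 hpos)
    have h2 : (1 / 64 * q ^ 2 + V + 1 / 4) + 7.3891 * (1 / 64 * q ^ 2 + 2 * V + 1 / 4) ≤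
        0.3494 * q ^ 2 + 2.1 := by linarith
    have h3 : 0.3494 * q ^ 2 + 2.1 ≤ t ^ 2 := by
      have e : t ^ 2 = 0.350464 * q ^ 2 - 1.776 * q + 9 / 4 := by rw [ht]; ring
      rw [e]; linarith
    linarith
  -- (b) the exponent inequality
  have hineq : 16 * Real.exp 6 *
      Real.exp (4 * (1 / 2 + Real.sqrt (t ^ 2)) * Real.log (3 / 2 + Real.sqrt (t ^ 2)))
      < Real.exp (2 * (n : ℝ)) := by
    rw [hsqrtr]
    have hq2' : 3 / 2 + t = 0.592 * q := by rw [ht]; ring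
    have hq1 : 1 / 2 + t = 0.592 * q - 1 := by rw [ht]; ring
    rw [hq2', hq1]
    have hlogθq : Real.log (0.592 * q) = Real.log 0.592 + Real.log q :=
      Real.log_mul (by norm_num) hqpos.ne'
    have hlogq : Real.log q = L - Real.log L := by
      rw [hq, Real.log_div hxpos.ne' hLpos.ne']
    have h16 : (16 : ℝ) * Real.exp 6 = Real.exp (4 * Real.log 2 + 6) := by
      rw [Real.exp_add, show (4 : ℝ) * Real.log 2 = Real.log (2 ^ 4) by
        rw [Real.log_pow]; norm_num, Real.exp_log (by norm_num)]
      norm_num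
    rw [h16, ← Real.exp_add, Real.exp_lt_exp, hlogθq, hlogq, show (n : ℝ) = x from rfl, hxqL]
    -- goal: 4 log 2 + 6 + 4 (0.592 q - 1) (log 0.592 + (L - log L)) < 2 (q L)
    have hθhi := log_0592_le
    have hθlo := log_0592_ge
    have hlogL1 : Real.log L ≤ L - 1 := Real.log_le_sub_one_of_pos hLpos
    have hlogLlo : 2.2697 ≤ Real.log L :=
      log_988_ge.trans (Real.log_le_log (by norm_num) hLlo)
    have hA : q * Real.log 0.592 ≤ q * (-0.509) := mul_le_mul_of_nonneg_left hθhi hqpos.le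
    have hB : q * 2.2697 ≤ q * Real.log L := mul_le_mul_of_nonneg_left hlogLlo hqpos.le
    have hC : q * L ≤ q * 11.0905 := mul_le_mul_of_nonneg_left hLhi hqpos.le
    linarith
  -- conclude by the master form with `R = q²/64`, `r = t²`
  have hn1 : 1 ≤ n := le_trans (by norm_num) hn
  exact xiSq_derivZeros_real_of_explicit hn1 hRpos (r := t ^ 2) hchain hineq w hw him

/-! ## The floor `n ≥ 20 000` -/

/-- **Effective Kim–Lee for `ξ₁` (RH-FREE), floor `n ≥ 20 000`:** every zero `w` of `ξ₁⁽ⁿ⁾` with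
`Im w ≠ 0` satisfies `(1/64)(n / log n)² ≤ ‖w‖`. -/
theorem xiSq_derivZeros_nonreal_far_of_le (n : ℕ) (hn : 20000 ≤ n) :
    ∀ w : ℂ, iteratedDeriv n xiSq w = 0 → w.im ≠ 0 →
      1 / 64 * ((n : ℝ) / Real.log n) ^ 2 ≤ ‖w‖ := by
  by_cases h : 65536 ≤ n
  · exact xiSq_derivZeros_nonreal_far n h
  · exact xiSq_derivZeros_nonreal_far_mid n hn (Nat.lt_of_not_le h)

/-- Contrapositive form: for `n ≥ 20 000`, every zero of `ξ₁⁽ⁿ⁾` of modulus `< (n / log n)²/64` is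
real. -/
theorem xiSq_derivZeros_real_below_of_le (n : ℕ) (hn : 20000 ≤ n) (w : ℂ)
    (hw : iteratedDeriv n xiSq w = 0) (hlt : ‖w‖ < 1 / 64 * ((n : ℝ) / Real.log n) ^ 2) :
    w.im = 0 := by
  by_contra him
  exact absurd (xiSq_derivZeros_nonreal_far_of_le n hn w hw him) (not_le.2 hlt)

end Summit.RiemannHypothesis.RiemannHypothesis.Theorems.JensenPolynomials.EffectiveKimLee

namespace Summit.RiemannHypothesis.RiemannHypothesis.Theorems.JensenPolynomials

open Literature.NumberTheory.LFunctions

/-- **The rung's ZERO-SIDE statement, PROVED (RH-FREE):** `XiDerivNonrealZeroBeyond chainFloor` — for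
`n ≥ 20 000` no NON-REAL zero of `ξ₁⁽ⁿ⁾ = iteratedDeriv n xiSq` has modulus below
`chainRadius n = (n / log n)²/64` (and no claim below `n = 20 000`). -/
theorem xiDerivNonrealZeroBeyond_chainFloor : XiDerivNonrealZeroBeyond chainFloor := by
  intro n z hz him
  by_cases h : 20000 ≤ n
  · rw [chainFloor_of_le h, chainRadius]
    have := EffectiveKimLee.xiSq_derivZeros_nonreal_far_of_le n h z hz him
    linarith
  · rw [chainFloor_of_lt (Nat.lt_of_not_le h)]
    exact norm_nonneg z

end Summit.RiemannHypothesis.RiemannHypothesis.Theorems.JensenPolynomials
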